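import Literature.NumberTheory.Rogawski1990.ArchExplicitTransferFactorRegular
import HarnessLib

/-!
# The central-character rule `Δ″_∞(zγ_H, zγ′) = μ_∞(z) · Δ″_∞(γ_H, γ′)` for Rogawski's explicit archimedean transfer factor
# (Rogawski 1990 §4.9 p. 55: «for `z ∈ Z`, `Δ_{G∕H}(zγ) = μ(z)Δ_{G∕H}(γ)`»)

Topic `NumberTheory/Rogawski1990`; namespace `Literature.NumberTheory.Rogawski1990`.  THEOREMS ONLY (no `def` ∕ fact ∕ `sorry` ∕ instance ∕ notation);
imports ★ `ArchExplicitTransferFactorRegular` (B-p12; hence ★ N1a `ArchExplicitTransferFactor`).  Cell `pub/hodgecm-mathlib`, F0∕P3a, topic T6, seat B-p12 (g25)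
(free-hand item (m1), P3a bus 2026-08-31 16:11Z; listed «NOT here (provers)» in the ★ N1a header).  HONEST LABEL: HC_CM is proved only modulo the printed
citations («named inputs remaining 2») until rung 0 closes; this file proves nothing of them — it records how print's factor `Δ″_∞` (★ `archExplicitDelta`)
transforms under the CENTRE: the rule by which transfer passes from `C_c(G)` to the spaces `C(G, ω)` of functions with central character ([§4.9 p. 55,
Prop. 4.9.1 is stated for `f ∈ C(G, ω)`, `f^H ∈ C(H, ωμ⁻¹)`]).

THE MATHEMATICS.  The centre of `G′_∞ = U(H′)(L⁺ ⊗ ℝ)` and of `H_∞` is `Z_∞ = U(1)(L⁺ ⊗ ℝ)` embedded as scalars; we phrase «`z` central with scalar `ζ`» by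
hypotheses on the matrices (`zH.1 = ζ·1₂`, `zH.2 = ζ·1₁`, `z = ζ·1₃`, the SAME `ζ ∈ L ⊗ ℝ`), so no new definition is needed.  Then for `γ_H = (g, u)`:
* `γ₂(zγ_H) = ζu`, `χ_{ζg}(ζu) = ζ²χ_g(u)` (Mathlib `charpoly_fin_two`), `det(ζg)⁻¹·ζ² = det g⁻¹` — so `τ`'s argument `−χ_g(u)·det g⁻¹` is INVARIANT and
  `τ(zγ_H) = μ_∞(ζu)·μ_∞(arg)⁻¹ = μ_∞(ζ)·τ(γ_H)` (★ `archHeckeValue` is multiplicative on units: ★ `infiniteIdeles` and `μ` are monoid homomorphisms);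
* `D_{G∕H,∞}(zγ_H) = Π_w |ζ_w|²·|χ_g(u)_w| = D_{G∕H,∞}(γ_H)` and `P_w(zγ_H, zγ′) = ζ_w² P_w(γ_H, γ′)`, `tr((ζ_w²P)ᴴ H (ζ_w²P)) = |ζ_w|⁴ tr(Pᴴ H P)`, so
  `κ_w` is invariant — because **`|ζ_w| = 1`** (`zH.2 ∈ U(Φ₁)(L⁺ ⊗ ℝ)`, ★ `star_evalC_archGammaTwo_mul_self`);
* matching is invariant: `ι(zγ_H) = ζ·ι(γ_H) ↔ ζγ′` iff `ι(γ_H) ↔ γ′` (a central unit scalar commutes with every conjugator).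
Hence **`archExplicitDelta_central_mul`**: `Δ″_∞(z_H γ_H, z γ′) = μ_∞(ζ) · Δ″_∞(γ_H, γ′)`.

## References
* [Rogawski1990] J. D. Rogawski, *Automorphic Representations of Unitary Groups in Three Variables*, Ann. of Math. Stud. 123 (1990): §4.9 p. 55 (`τ`, `D_{G∕H}`,
  `Δ_{G∕H}`, «`Δ_{G∕H}(zγ) = μ(z)Δ_{G∕H}(γ)`», Prop. 4.9.1 on `C(G, ω)`), §4.3 p. 43, §14.6 p. 242.
-/

set_option autoImplicit false

noncomputable section

open NumberField NumberField.InfinitePlace Matrix Polynomial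
open Literature.NumberTheory.GaloisRepresentations
open scoped MatrixGroups ComplexOrder

namespace Literature.NumberTheory.Rogawski1990

open Literature.NumberTheory.Automorphic

section Central

variable (L : Type) [Field L] [NumberField L] [IsCMField L] (H' : Matrix (Fin 3) (Fin 3) L)
  (zH a : ↥(UnitaryGroup.arch (↥(maximalRealSubfield L)) L (IsCMField.complexConj L) 2
      (Matrix.of fun i j : Fin 2 => if i.val + j.val + 1 = 2 then (1 : L) else 0)) ×
    ↥(UnitaryGroup.arch (↥(maximalRealSubfield L)) L (IsCMField.complexConj L) 1
      (Matrix.of fun i j : Fin 1 => if i.val + j.val + 1 = 1 then (1 : L) else 0)))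
  (z b : ↥(UnitaryGroup.arch (↥(maximalRealSubfield L)) L (IsCMField.complexConj L) 3 H'))
  (ζ : mixedEmbedding.mixedSpace L)
  (hz1 : (((zH.1 : ↥(UnitaryGroup.arch (↥(maximalRealSubfield L)) L (IsCMField.complexConj L) 2
      (Matrix.of fun i j : Fin 2 => if i.val + j.val + 1 = 2 then (1 : L) else 0))) :
        GL (Fin 2) (mixedEmbedding.mixedSpace L)) : Matrix (Fin 2) (Fin 2) (mixedEmbedding.mixedSpace L)) = ζ • 1)
  (hz2 : (((zH.2 : ↥(UnitaryGroup.arch (↥(maximalRealSubfield L)) L (IsCMField.complexConj L) 1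
      (Matrix.of fun i j : Fin 1 => if i.val + j.val + 1 = 1 then (1 : L) else 0))) :
        GL (Fin 1) (mixedEmbedding.mixedSpace L)) : Matrix (Fin 1) (Fin 1) (mixedEmbedding.mixedSpace L)) = ζ • 1)
  (hz : ((z : GL (Fin 3) (mixedEmbedding.mixedSpace L)) : Matrix (Fin 3) (Fin 3) (mixedEmbedding.mixedSpace L)) = ζ • 1)

/-! ## §1 `μ_∞` is multiplicative on units -/

omit [IsCMField L] in
/-- `μ_∞(xy) = μ_∞(x) μ_∞(y)` for units `x, y ∈ L ⊗ ℝ` (★ `infiniteIdeles` and `μ` are monoid homomorphisms). [cite: Rogawski1990, §4.9 p. 55] -/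
theorem archHeckeValue_mul (μ : HeckeCharacter L) {x y : mixedEmbedding.mixedSpace L} (hx : IsUnit x) (hy : IsUnit y) :
    archHeckeValue L μ (x * y) = archHeckeValue L μ x * archHeckeValue L μ y := by
  classical
  unfold archHeckeValue
  rw [dif_pos (hx.mul hy), dif_pos hx, dif_pos hy, IsUnit.unit_mul, map_mul, map_mul, map_mul, Units.val_mul]

/-! ## §2 The `γ_H`-side quantities under a central `z_H = (ζ·1₂, ζ·1₁)` -/

include hz2 in
/-- `γ₂(z_H) = ζ`. [cite: Rogawski1990, §4.9 p. 55] -/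
theorem archGammaTwo_of_central : archGammaTwo L zH = ζ := by
  unfold archGammaTwo
  rw [hz2, Matrix.smul_apply, Matrix.one_apply_eq, smul_eq_mul, mul_one]

include hz2 in
/-- `ζ` is a unit of `L ⊗ ℝ` (it is `det z_H.2`). [cite: Rogawski1990, §4.9 p. 55] -/
theorem isUnit_of_central : IsUnit ζ := by
  rw [← archGammaTwo_of_central L zH ζ hz2]
  exact isUnit_archGammaTwo L zH

include hz2 in
/-- **`|ζ_w| = 1`** at every complex place (`z_H.2 ∈ U(Φ₁)(L⁺ ⊗ ℝ)`). [cite: Rogawski1990, §4.9 p. 55] -/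
theorem star_evalC_central_mul_self (w : {w : InfinitePlace L // IsComplex w}) :
    starRingEnd ℂ (UnitaryGroup.evalC L w ζ) * UnitaryGroup.evalC L w ζ = 1 := by
  rw [← archGammaTwo_of_central L zH ζ hz2]
  exact star_evalC_archGammaTwo_mul_self L zH w

include hz2 in
/-- `γ₂(z_H γ_H) = ζ · γ₂(γ_H)`. [cite: Rogawski1990, §4.9 p. 55] -/
theorem archGammaTwo_central_mul : archGammaTwo L (zH * a) = ζ * archGammaTwo L a := by
  have h : (((zH * a).2 : ↥(UnitaryGroup.arch (↥(maximalRealSubfield L)) L (IsCMField.complexConj L) 1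
      (Matrix.of fun i j : Fin 1 => if i.val + j.val + 1 = 1 then (1 : L) else 0))) : GL (Fin 1) (mixedEmbedding.mixedSpace L)) =
      (zH.2 : GL (Fin 1) (mixedEmbedding.mixedSpace L)) * (a.2 : GL (Fin 1) (mixedEmbedding.mixedSpace L)) := by
    simp [Prod.snd_mul]
  unfold archGammaTwo
  rw [h, Units.val_mul, hz2, Matrix.smul_mul, Matrix.one_mul, Matrix.smul_apply, smul_eq_mul]

include hz1 in
/-- The `U(Φ₂)`-part of `z_H γ_H` is `ζ · g`. [cite: Rogawski1990, §4.9 p. 55] -/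
theorem coe_fst_central_mul :
    ((((zH * a).1 : ↥(UnitaryGroup.arch (↥(maximalRealSubfield L)) L (IsCMField.complexConj L) 2
        (Matrix.of fun i j : Fin 2 => if i.val + j.val + 1 = 2 then (1 : L) else 0))) : GL (Fin 2) (mixedEmbedding.mixedSpace L)) :
        Matrix (Fin 2) (Fin 2) (mixedEmbedding.mixedSpace L)) =
      ζ • (((a.1 : ↥(UnitaryGroup.arch (↥(maximalRealSubfield L)) L (IsCMField.complexConj L) 2
        (Matrix.of fun i j : Fin 2 => if i.val + j.val + 1 = 2 then (1 : L) else 0))) : GL (Fin 2) (mixedEmbedding.mixedSpace L)) :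
        Matrix (Fin 2) (Fin 2) (mixedEmbedding.mixedSpace L)) := by
  have h : (((zH * a).1 : ↥(UnitaryGroup.arch (↥(maximalRealSubfield L)) L (IsCMField.complexConj L) 2
      (Matrix.of fun i j : Fin 2 => if i.val + j.val + 1 = 2 then (1 : L) else 0))) : GL (Fin 2) (mixedEmbedding.mixedSpace L)) =
      (zH.1 : GL (Fin 2) (mixedEmbedding.mixedSpace L)) * (a.1 : GL (Fin 2) (mixedEmbedding.mixedSpace L)) := by
    simp [Prod.fst_mul]
  rw [h, Units.val_mul, hz1, Matrix.smul_mul, Matrix.one_mul]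

include hz1 hz2 in
/-- **`χ_{ζg}(ζu) = ζ² · χ_g(u)`** (Mathlib `charpoly_fin_two`: `tr(ζg) = ζ tr g`, `det(ζg) = ζ² det g`). [cite: Rogawski1990, §4.9 p. 55] -/
theorem eval_archCharpolyTwo_central_mul :
    (archCharpolyTwo L (zH * a)).eval (archGammaTwo L (zH * a)) = ζ ^ 2 * (archCharpolyTwo L a).eval (archGammaTwo L a) := by
  unfold archCharpolyTwo
  rw [coe_fst_central_mul L zH a ζ hz1, archGammaTwo_central_mul L zH a ζ hz2, Matrix.charpoly_fin_two, Matrix.charpoly_fin_two,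
    Matrix.trace_smul, Matrix.det_smul, Fintype.card_fin]
  simp only [eval_add, eval_sub, eval_mul, eval_pow, eval_X, eval_C, smul_eq_mul]
  ring

include hz1 in
/-- `det((ζg)⁻¹) · ζ² = det(g⁻¹)` — the determinant of the inverse `U(Φ₂)`-part absorbs `ζ²`. [cite: Rogawski1990, §4.9 p. 55] -/
theorem det_inv_fst_central_mul :
    (((((zH * a).1 : ↥(UnitaryGroup.arch (↥(maximalRealSubfield L)) L (IsCMField.complexConj L) 2
        (Matrix.of fun i j : Fin 2 => if i.val + j.val + 1 = 2 then (1 : L) else 0))) : GL (Fin 2) (mixedEmbedding.mixedSpace L))⁻¹ :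
        GL (Fin 2) (mixedEmbedding.mixedSpace L)) : Matrix (Fin 2) (Fin 2) (mixedEmbedding.mixedSpace L)).det * ζ ^ 2 =
      ((((a.1 : ↥(UnitaryGroup.arch (↥(maximalRealSubfield L)) L (IsCMField.complexConj L) 2
        (Matrix.of fun i j : Fin 2 => if i.val + j.val + 1 = 2 then (1 : L) else 0))) : GL (Fin 2) (mixedEmbedding.mixedSpace L))⁻¹ :
        GL (Fin 2) (mixedEmbedding.mixedSpace L)) : Matrix (Fin 2) (Fin 2) (mixedEmbedding.mixedSpace L)).det := by
  have h : (((zH * a).1 : ↥(UnitaryGroup.arch (↥(maximalRealSubfield L)) L (IsCMField.complexConj L) 2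
      (Matrix.of fun i j : Fin 2 => if i.val + j.val + 1 = 2 then (1 : L) else 0))) : GL (Fin 2) (mixedEmbedding.mixedSpace L)) =
      (zH.1 : GL (Fin 2) (mixedEmbedding.mixedSpace L)) * (a.1 : GL (Fin 2) (mixedEmbedding.mixedSpace L)) := by
    simp [Prod.fst_mul]
  have hdetz : (((zH.1 : ↥(UnitaryGroup.arch (↥(maximalRealSubfield L)) L (IsCMField.complexConj L) 2
      (Matrix.of fun i j : Fin 2 => if i.val + j.val + 1 = 2 then (1 : L) else 0))) : GL (Fin 2) (mixedEmbedding.mixedSpace L)) :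
        Matrix (Fin 2) (Fin 2) (mixedEmbedding.mixedSpace L)).det = ζ ^ 2 := by
    rw [hz1, Matrix.det_smul, Fintype.card_fin, Matrix.det_one, mul_one]
  have hinv : (((zH.1 : ↥(UnitaryGroup.arch (↥(maximalRealSubfield L)) L (IsCMField.complexConj L) 2
      (Matrix.of fun i j : Fin 2 => if i.val + j.val + 1 = 2 then (1 : L) else 0))) : GL (Fin 2) (mixedEmbedding.mixedSpace L))⁻¹ :
        GL (Fin 2) (mixedEmbedding.mixedSpace L)).val.det * ζ ^ 2 = 1 := by
    rw [← hdetz, ← Matrix.det_mul, ← Units.val_mul, inv_mul_cancel, Units.val_one, Matrix.det_one]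
  rw [h, _root_.mul_inv_rev, Units.val_mul, Matrix.det_mul, mul_assoc, hinv, mul_one]

include hz1 hz2 in
/-- **`τ`'s argument is central-invariant**: `−χ_{ζg}(ζu)·det(ζg)⁻¹ = −χ_g(u)·det g⁻¹`. [cite: Rogawski1990, §4.9 p. 55] -/
theorem archTauArg_central_mul : archTauArg L (zH * a) = archTauArg L a := by
  unfold archTauArg
  rw [eval_archCharpolyTwo_central_mul L zH a ζ hz1 hz2, ← det_inv_fst_central_mul L zH a ζ hz1]
  ring

include hz1 hz2 in
/-- **`τ(z_H γ_H) = μ_∞(ζ) · τ(γ_H)`**. [cite: Rogawski1990, §4.9 p. 55] -/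
theorem archTau_central_mul (μ : HeckeCharacter L) : archTau L (zH * a) μ = archHeckeValue L μ ζ * archTau L a μ := by
  unfold archTau
  rw [archTauArg_central_mul L zH a ζ hz1 hz2, archGammaTwo_central_mul L zH a ζ hz2,
    archHeckeValue_mul L μ (isUnit_of_central L zH ζ hz2) (isUnit_archGammaTwo L a), mul_assoc]

include hz1 hz2 in
open scoped Classical in
/-- **`D_{G∕H,∞}(z_H γ_H) = D_{G∕H,∞}(γ_H)`** (`|ζ_w| = 1` at every complex place). [cite: Rogawski1990, §4.9 p. 55] -/
theorem archWeylRatio_central_mul : archWeylRatio L (zH * a) = archWeylRatio L a := by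
  unfold archWeylRatio
  rw [eval_archCharpolyTwo_central_mul L zH a ζ hz1 hz2]
  refine Finset.prod_congr rfl fun w _ => ?_
  have h1 : ‖UnitaryGroup.evalC L w ζ‖ = 1 := by
    have h := congrArg (fun t : ℂ => ‖t‖) (star_evalC_central_mul_self L zH ζ hz2 w)
    simp only [norm_mul, Complex.norm_conj, norm_one] at h
    nlinarith [norm_nonneg (UnitaryGroup.evalC L w ζ)]
  rw [map_mul, map_pow, norm_mul, norm_pow, h1, one_pow, one_mul]

/-! ## §3 The pair quantities: `P_w ↦ ζ_w² P_w`, `κ_w` invariant, matching invariant -/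

include hz1 hz in
/-- **`P_w(z_H γ_H, z γ′) = ζ_w² · P_w(γ_H, γ′)`**. [cite: Rogawski1990, §14.6 p. 242] -/
theorem archEigenlineProjector_central_mul (w : {w : InfinitePlace L // IsComplex w}) :
    archEigenlineProjector L H' (zH * a) w (z * b) = (UnitaryGroup.evalC L w ζ) ^ 2 • archEigenlineProjector L H' a w b := by
  have hb : (((z * b : ↥(UnitaryGroup.arch (↥(maximalRealSubfield L)) L (IsCMField.complexConj L) 3 H')) :
      GL (Fin 3) (mixedEmbedding.mixedSpace L)) : Matrix (Fin 3) (Fin 3) (mixedEmbedding.mixedSpace L)) =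
      ζ • ((b : GL (Fin 3) (mixedEmbedding.mixedSpace L)) : Matrix (Fin 3) (Fin 3) (mixedEmbedding.mixedSpace L)) := by
    rw [Subgroup.coe_mul, Units.val_mul, hz, Matrix.smul_mul, Matrix.one_mul]
  dsimp only [archEigenlineProjector]
  rw [hb, coe_fst_central_mul L zH a ζ hz1,
    Matrix.map_smul' _ _ _ (fun x y => map_mul (UnitaryGroup.evalC L w) x y),
    Matrix.map_smul' _ _ _ (fun x y => map_mul (UnitaryGroup.evalC L w) x y), Matrix.trace_smul, Matrix.det_smul, Fintype.card_fin]
  simp only [smul_eq_mul, Matrix.smul_mul, Matrix.mul_smul, smul_smul, smul_sub, smul_add]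
  ring_nf

include hz1 hz2 hz in
/-- **`κ_w(z_H γ_H, z γ′) = κ_w(γ_H, γ′)`**: `tr((ζ_w²P)ᴴ H (ζ_w²P)) = |ζ_w|⁴ · tr(Pᴴ H P) = tr(Pᴴ H P)`. [cite: Rogawski1990, §14.6 p. 242] -/
theorem archKappaAt_central_mul (w : {w : InfinitePlace L // IsComplex w}) :
    archKappaAt L H' (zH * a) w (z * b) = archKappaAt L H' a w b := by
  unfold archKappaAt
  rw [archEigenlineProjector_central_mul L H' zH a z b ζ hz1 hz w, Matrix.conjTranspose_smul, Matrix.smul_mul, Matrix.smul_mul, Matrix.mul_smul,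
    smul_smul, Matrix.trace_smul, smul_eq_mul]
  have h1 : star (UnitaryGroup.evalC L w ζ ^ 2) * UnitaryGroup.evalC L w ζ ^ 2 = 1 := by
    rw [star_pow, ← mul_pow, Complex.star_def, star_evalC_central_mul_self L zH ζ hz2 w, one_pow]
  rw [h1, one_mul]

include hz1 hz2 hz in
/-- **Matching is central-invariant**: `ι(z_H γ_H) ↔ z γ′` iff `ι(γ_H) ↔ γ′` — `ι(z_H)` and `z` are the same central scalar `ζ·1` of `GL₃(L ⊗ ℝ)`, which
commutes with every conjugator. [cite: Rogawski1990, §14.1 p. 232; §4.9 p. 55] -/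
theorem isArchNormPair_central_mul : IsArchNormPair L H' (zH * a) (z * b) ↔ IsArchNormPair L H' a b := by
  rw [isArchNormPair_iff, isArchNormPair_iff, map_mul]
  -- the two central scalars agree in `GL₃(L ⊗ ℝ)`
  have hι : ((endoEmbArch L zH : ↥(UnitaryGroup.arch (↥(maximalRealSubfield L)) L (IsCMField.complexConj L) 3
      (Matrix.of fun i j : Fin 3 => if i.val + j.val + 1 = 3 then (1 : L) else 0))) : GL (Fin 3) (mixedEmbedding.mixedSpace L)) =
      (z : GL (Fin 3) (mixedEmbedding.mixedSpace L)) := by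
    apply Units.ext
    rw [hz, coe_endoEmbArch, coe_endoGL_eq, hz1, hz2]
    refine Matrix.ext fun i j => ?_
    fin_cases i <;> fin_cases j <;> simp [Matrix.smul_apply]
  set ζG := (z : GL (Fin 3) (mixedEmbedding.mixedSpace L)) with hζG
  have hcen : ∀ x : GL (Fin 3) (mixedEmbedding.mixedSpace L), ζG * x = x * ζG := fun x => by
    apply Units.ext
    rw [Units.val_mul, Units.val_mul, hz, Matrix.smul_mul, Matrix.mul_smul, Matrix.one_mul, Matrix.mul_one]
  have key : ∀ x y : GL (Fin 3) (mixedEmbedding.mixedSpace L), IsConj (ζG * x) (ζG * y) ↔ IsConj x y := fun x y => by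
    constructor
    · intro h
      obtain ⟨c, hc⟩ := isConj_iff.1 h
      refine isConj_iff.2 ⟨c, ?_⟩
      have h2 : c * (ζG * x) * c⁻¹ = ζG * (c * x * c⁻¹) := by
        calc c * (ζG * x) * c⁻¹ = (c * ζG) * x * c⁻¹ := by group
          _ = (ζG * c) * x * c⁻¹ := by rw [hcen c]
          _ = ζG * (c * x * c⁻¹) := by group
      rw [h2] at hc
      exact mul_left_cancel hc
    · intro h
      obtain ⟨c, hc⟩ := isConj_iff.1 h
      refine isConj_iff.2 ⟨c, ?_⟩
      have h2 : c * (ζG * x) * c⁻¹ = ζG * (c * x * c⁻¹) := by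
        calc c * (ζG * x) * c⁻¹ = (c * ζG) * x * c⁻¹ := by group
          _ = (ζG * c) * x * c⁻¹ := by rw [hcen c]
          _ = ζG * (c * x * c⁻¹) := by group
      rw [h2, hc]
  unfold Corresponds
  rw [Subgroup.coe_mul, Subgroup.coe_mul, hι]
  exact key _ _

/-! ## §4 The rule -/

include hz1 hz2 hz in
open scoped Classical in
/-- **THE CENTRAL-CHARACTER RULE `Δ″_∞(z_H γ_H, z γ′) = μ_∞(ζ) · Δ″_∞(γ_H, γ′)`** for print's explicit archimedean factor, `z_H = (ζ·1₂, ζ·1₁) ∈ H_∞` and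
`z = ζ·1₃ ∈ G′_∞` central with the same scalar `ζ ∈ U(1)(L⁺ ⊗ ℝ)` («`Δ_{G∕H}(zγ) = μ(z)Δ_{G∕H}(γ)`»). [cite: Rogawski1990, §4.9 p. 55] -/
theorem archExplicitDelta_central_mul (μ : HeckeCharacter L) :
    archExplicitDelta L H' (zH * a) μ (z * b) = archHeckeValue L μ ζ * archExplicitDelta L H' a μ b := by
  by_cases h : IsArchNormPair L H' a b
  · rw [archExplicitDelta_of_isArchNormPair L H' _ μ ((isArchNormPair_central_mul L H' zH a z b ζ hz1 hz2 hz).2 h),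
      archExplicitDelta_of_isArchNormPair L H' _ μ h, archTau_central_mul L zH a ζ hz1 hz2 μ, archWeylRatio_central_mul L zH a ζ hz1 hz2]
    have hk : (∏ w : {w : InfinitePlace L // IsComplex w}, archKappaAt L H' (zH * a) w (z * b)) =
        ∏ w : {w : InfinitePlace L // IsComplex w}, archKappaAt L H' a w b :=
      Finset.prod_congr rfl fun w _ => archKappaAt_central_mul L H' zH a z b ζ hz1 hz2 hz w
    rw [hk]
    ring
  · rw [archExplicitDelta_of_not_isArchNormPair L H' _ μ (fun h' => h ((isArchNormPair_central_mul L H' zH a z b ζ hz1 hz2 hz).1 h')),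
      archExplicitDelta_of_not_isArchNormPair L H' _ μ h, mul_zero]

end Central

end Literature.NumberTheory.Rogawski1990

end
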